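import Mathlib.RingTheory.IntegralClosure.IsIntegralClosure.Basic
import Mathlib.RingTheory.Adjoin.Basic
import Mathlib.Algebra.Algebra.Subalgebra.Tower
import HarnessLib

/-!
# Subalgebras over which a ring generated by power-torsion elements is integral
(crux `FInjectiveMacaulayfication`, line `Sketch`)

Support file for crux stmt-ResolutionOfSingularities-15315 (`FrobeniusLadder.FInjectiveMacaulayfication`,
line `Sketch`), stub `stub_subalgebraIntegralOfPow` of the cycle-9 WEIGHTED CONE ENGINE (§15 of the
registered skeleton 10f06f91). In the engine `B = k[X]/(g)` is a graded hypersurface ring, `A ⊆ B` the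
`k`-subalgebra of weighted-degree-`0` classes, and every variable class `x_j` has a power `x_j ^ e ∈ A`
(`e` = the order of its weight in `ℤ/w_v`); the stub concludes that `B` is integral over `A`, which feeds
the finite graded descent step (dimension and maximal ideals of `A` versus `B`).

* `stub_subalgebraIntegralOfPow` — if `B` is generated as a `k`-algebra by a set `S` each of whose
  elements has a positive power in the `k`-subalgebra `A`, then `B` is an integral `A`-algebra.

Proof: `Algebra.adjoin_induction` with motive `IsIntegral A x`; a generator `s` with `s ^ e ∈ A`,
`0 < e`, is integral by `IsIntegral.of_pow` (it is a root of `T ^ e - s ^ e ∈ A[T]`); scalars lie in `A`;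
sums and products of integral elements are integral. [folklore]
-/

-- single-problem summit: the doubled namespace component is forced
set_option linter.dupNamespace false

namespace Summit.ResolutionOfSingularities.ResolutionOfSingularities.Theorems.FInjectiveMacaulayfication.SubalgebraIntegralOfPow

/-- Elements of a subalgebra are integral over it (as elements of the ambient ring). -/
theorem isIntegral_of_mem {k B : Type} [Field k] [CommRing B] [Algebra k B] (A : Subalgebra k B)
    {y : B} (hy : y ∈ A) : IsIntegral A y := by
  have h : algebraMap A B ⟨y, hy⟩ = y := rfl
  rw [← h]
  exact isIntegral_algebraMap

/-- **`stub_subalgebraIntegralOfPow`** (registered signature, skeleton 10f06f91 of crux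
stmt-ResolutionOfSingularities-15315): if the `k`-algebra `B` is generated by a set `S` and every
`s ∈ S` has a power `s ^ e ∈ A` with `0 < e`, then `B` is integral over the `k`-subalgebra `A`.
[folklore; `Algebra.adjoin_induction` + `IsIntegral.of_pow`] -/
theorem stub_subalgebraIntegralOfPow : ∀ (k B : Type) [Field k] [CommRing B] [Algebra k B]
    (A : Subalgebra k B) (S : Set B), Algebra.adjoin k S = ⊤ →
    (∀ s ∈ S, ∃ e : ℕ, 0 < e ∧ s ^ e ∈ A) → Algebra.IsIntegral A B := by
  intro k B _ _ _ A S hS hpow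
  refine ⟨fun x => ?_⟩
  have hx : x ∈ Algebra.adjoin k S := by
    rw [hS]
    exact Algebra.mem_top
  refine Algebra.adjoin_induction (p := fun y _ => IsIntegral A y) ?_ ?_ ?_ ?_ hx
  · intro s hs
    obtain ⟨e, he, hse⟩ := hpow s hs
    exact IsIntegral.of_pow he (isIntegral_of_mem A hse)
  · intro r
    exact isIntegral_of_mem A (A.algebraMap_mem r)
  · intro y z _ _ hy hz
    exact hy.add hz
  · intro y z _ _ hy hz
    exact hy.mul hz

end Summit.ResolutionOfSingularities.ResolutionOfSingularities.Theorems.FInjectiveMacaulayfication.SubalgebraIntegralOfPow
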